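import Summits.CriticalPhenomena.PercolationContinuityZ3.Theorems.PercNearOneGluingNoHeavyLowerTailKnQuestion8CoefficientwiseRemSPPieces
import Summits.CriticalPhenomena.PercolationContinuityZ3.Theorems.PercNearOneGluingNoHeavyLowerTailKnQuestion8CoefficientwiseComponentFlip
import Mathlib.Combinatorics.SetFamily.FourFunctions
import HarnessLib

/-!
# The N-row of CONJECTURE U3 holds — with the IDENTITY bijection — on every piece with a DOMINATING vertex (apex lemma) — prim-lf-2 gen 70

Helper file (`--supports stmt-CriticalPhenomena-4575`, closed), prover `prim-lf-2` (gen 70).  Memo `prim-lf-2/CW-STRIP-gen70.md` (§ apex lemma), CANDIDATES G70.7.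
No named facts, no sorries; standard axioms.

Setting as in `…CoefficientwiseRemSPPieces`: multigraph `ends : ι → Sym2 V`, piece `D` (edge set) with root terminal `x` and second terminal `h`, colouring `t ⊆ D`
(red edges), `A^x = C_x(t)`, `B^x = C_x(D ∖ t)` (`C_a(s) = openCluster (ends '' s) a`).  A vertex `c` is an APEX of `D` if every vertex `v ≠ c` lying on an edge of
`D` is joined to `c` by an edge of `D` — hypothesis `hapex : ∀ e ∈ D, ∀ v ∈ ends e, v ≠ c → ∃ f ∈ D, ends f = s(c, v)` (kept inline, no new definition).
* `Coefficientwise.apex_blue_subset_red` — **apex lemma**: if `c` is an apex, `c ∈ A^x` and `c ∉ B^x`, then `B^x ⊆ A^x` pointwise (every vertex of `B^x` other than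
  `x` has its spoke to `c`, which cannot be blue, so it is red and the vertex hangs red from `c ∈ A^x`).
* `Coefficientwise.pieceN_apex` — on a piece with an apex `c` (spokes at `x` and `h` present), every colouring of the class `N` (`pieceN`: `h ∉ A^x ∪ B^x`,
  no target in `A^x ∩ B^x`, none in `A^h ∩ B^x`, some in `A^x ∩ B^h`) has `c ∈ A^x` and `c ∉ B^x`.
* `Coefficientwise.hasDomRow_pieceN_of_apex` — hence the N-row `HasDomRow ends D x (pieceN ends D x h W)` holds for EVERY target set `W` on every piece with an apex,
  realised by the identity map: one third of `InU3` (CONJECTURE U3) for all cones / wheels / apex graphs, for every root edge avoiding the apex.  (The two R-rows on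
  apex pieces hold in all censused cases but need a genuine bijection in general; see the memo.)
* `Coefficientwise.pieceR_apex_mem`, `hasDomRow_pieceR0/R1_of_apex_mem` — when the apex is itself a TARGET (`c ∈ W`) the classes `R0`, `R1` also force `c ∈ A^x ∖ B^x`,
  so their rows hold with the identity; `Coefficientwise.rem_nonneg_of_apex_mem` — **(REM) ≥ 0 for every root edge `e = xp` of `E` such that `E.erase e` has an apex
  `c` (off `e`), for every target set `W ∋ c` and every monotone `g`** (wheels, cones, complete graphs …).
* `Coefficientwise.blue_subset_red_of_apex_snd`, `hasDomRow_pieceR0/R1_of_apex_snd` — if the SECOND terminal `h` is dominating then on `R0`/`R1` already `B^x ⊆ A^x`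
  (identity rows, every `W`); `Coefficientwise.rem_nonneg_of_apex_snd_of_pieceN` — hence for a root edge `e = xp` with `p` dominating in `E.erase e` (spoke root of a
  wheel/cone seen from the rim) `(REM)` follows from the N-row of `(E.erase e; x, p)` alone; dually `Coefficientwise.rem_nonneg_of_apex_of_pieceR` — with an apex
  `c ∉ e` (REM) follows from the two point rows `R0`, `R1` alone (CONJECTURE APEX-R of the memo).
* `Coefficientwise.blue_subset_red_of_dom_snd`, `hasDomRow_pieceR0/R1_of_dom_snd`, `rem_nonneg_of_dom_snd_of_rowN` — the SPOKE-ROOT form of the previous bullet: `h`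
  joined to every vertex `∉ {x, h}` (as in `E.erase e` for a cone/wheel), identity point rows, and (REM) from the LINEAR N-row inequality (proved on paper for every graph,
  memo §5d THEOREM (★★): the apex-weighted double-cluster form is a sum over Boolean cubes of Harris-positive blocks).
* `Coefficientwise.cube_harris_diff_nonneg` — the Boolean-cube inequality `0 ≤ Σ_I (φ I − φ Iᶜ)(ψ I − ψ Iᶜ)` (monotone `φ, ψ`) behind THEOREM (★★), from Mathlib's `fkg`.
[cite: KozmaNitzan2024, Questions 8–9 (§5.5 p. 36) (context: the Question-8 pocket covariance programme)]
-/

namespace Summit.CriticalPhenomena.PercolationContinuityZ3.Theorems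

open Finset Literature.Probability.Percolation

namespace Coefficientwise

variable {ι V : Type*} [DecidableEq ι] (ends : ι → Sym2 V)

/-- **Apex lemma.**  If `c` is an apex of `D`, `c ∈ C_x(t)` and `c ∉ C_x(D ∖ t)`, then `C_x(D ∖ t) ⊆ C_x(t)`: the blue cluster of `x` lies inside its red
cluster, vertex by vertex. [cite: KozmaNitzan2024, Questions 8–9 (§5.5 p. 36) (context)] -/
theorem apex_blue_subset_red {D : Finset ι} {c x : V} (hapex : ∀ e ∈ D, ∀ v : V, v ∈ ends e → v ≠ c → ∃ f ∈ D, ends f = s(c, v)) {t : Finset ι}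
    (hc : c ∈ openCluster (ends '' (↑t : Set ι)) x) (hc' : c ∉ openCluster (ends '' (↑(D \ t) : Set ι)) x) :
    openCluster (ends '' (↑(D \ t) : Set ι)) x ⊆ openCluster (ends '' (↑t : Set ι)) x := by
  intro v hv
  by_cases hvx : v = x
  · subst hvx; exact mem_openCluster_self _ _
  have hvc : v ≠ c := fun h => hc' (h ▸ hv)
  obtain ⟨e, heDt, hve⟩ := exists_edge_of_mem_openCluster ends hv hvx
  obtain ⟨f, hfD, hfe⟩ := hapex e (Finset.mem_sdiff.mp heDt).1 v hve hvc
  by_cases hft : f ∈ t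
  · -- the spoke is red: `v` hangs red from `c ∈ C_x(t)`
    exact mem_openCluster_of_edge ends hft hfe hc
  · -- the spoke is blue: then `c` would be blue-joined to `x`
    have hf' : f ∈ D \ t := Finset.mem_sdiff.mpr ⟨hfD, hft⟩
    exact absurd (mem_openCluster_of_edge ends hf' (show ends f = s(v, c) by rw [hfe, Sym2.eq_swap]) hv) hc'

/-- **Class `N` on an apex piece forces `c ∈ A^x ∖ B^x`.**  Let `c` be an apex of `D` with spokes `fx` (ends `{c,x}`) and `fh` (ends `{c,h}`) in `D`.  If `t ⊆ D` is in the class `N` for the terminals `(x,h)` and any target set `W`, then `c ∈ C_x(t)` and `c ∉ C_x(D ∖ t)`.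
[cite: KozmaNitzan2024, Questions 8–9 (§5.5 p. 36) (context)] -/
theorem pieceN_apex {D : Finset ι} {c x h : V} (hapex : ∀ e ∈ D, ∀ v : V, v ∈ ends e → v ≠ c → ∃ f ∈ D, ends f = s(c, v)) {fx fh : ι} (hfxD : fx ∈ D) (hfx : ends fx = s(c, x))
    (hfhD : fh ∈ D) (hfh : ends fh = s(c, h)) {W : Set V} {t : Finset ι} (htD : t ⊆ D) (hN : pieceN ends D x h W t) :
    c ∈ openCluster (ends '' (↑t : Set ι)) x ∧ c ∉ openCluster (ends '' (↑(D \ t) : Set ι)) x := by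
  obtain ⟨hhA, hhB, hcore, hhx, ⟨w, hwW, hwA, hwBh⟩⟩ := hN
  by_cases hfht : fh ∈ t
  · -- the spoke at `h` is red: `c ∈ C_h(t)`; then `c ∉ C_x(t)`, the spoke at `x` is blue, `c ∈ C_x(D∖t)`, and the witness `w` becomes a core target
    exfalso
    have hcAh : h ∈ openCluster (ends '' (↑t : Set ι)) c :=
      mem_openCluster_of_edge ends hfht hfh (mem_openCluster_self _ c)
    have hcAx : c ∉ openCluster (ends '' (↑t : Set ι)) x :=
      fun hcx' => hhA (SimpleGraph.Reachable.trans hcx' hcAh)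
    have hfxt : fx ∉ t := fun hfxt => hcAx (mem_openCluster_of_edge ends hfxt (show ends fx = s(x, c) by rw [hfx, Sym2.eq_swap]) (mem_openCluster_self _ x))
    have hcBx : c ∈ openCluster (ends '' (↑(D \ t) : Set ι)) x :=
      mem_openCluster_of_edge ends (Finset.mem_sdiff.mpr ⟨hfxD, hfxt⟩) (show ends fx = s(x, c) by rw [hfx, Sym2.eq_swap]) (mem_openCluster_self _ x)
    have hwc : w ≠ c := fun h => hcAx (h ▸ hwA)
    have hwx : w ≠ x := by
      intro h; subst h
      exact hhB (SimpleGraph.Reachable.symm hwBh)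
    obtain ⟨e, het, hwe⟩ := exists_edge_of_mem_openCluster ends hwA hwx
    obtain ⟨f, hfD, hfe⟩ := hapex e (htD het) w hwe hwc
    by_cases hft : f ∈ t
    · exact hcAx (SimpleGraph.Reachable.trans hwA
        ((mem_openCluster_of_edge ends hft (show ends f = s(w, c) by rw [hfe, Sym2.eq_swap]) (mem_openCluster_self _ w)) : c ∈ openCluster _ w))
    · have hwBx : w ∈ openCluster (ends '' (↑(D \ t) : Set ι)) x :=
        mem_openCluster_of_edge ends (Finset.mem_sdiff.mpr ⟨hfD, hft⟩) hfe hcBx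
      exact hcore w hwW ⟨hwA, hwBx⟩
  · -- the spoke at `h` is blue: `c ∈ C_h(D∖t)`, so `c ∉ C_x(D∖t)`, so the spoke at `x` is red
    have hfh' : fh ∈ D \ t := Finset.mem_sdiff.mpr ⟨hfhD, hfht⟩
    have hcBx : c ∉ openCluster (ends '' (↑(D \ t) : Set ι)) x := by
      intro hcBx
      exact hhB (mem_openCluster_of_edge ends hfh' hfh hcBx)
    have hfxt : fx ∈ t := by
      by_contra hfxt
      exact hcBx (mem_openCluster_of_edge ends (Finset.mem_sdiff.mpr ⟨hfxD, hfxt⟩) (show ends fx = s(x, c) by rw [hfx, Sym2.eq_swap]) (mem_openCluster_self _ x))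
    exact ⟨mem_openCluster_of_edge ends hfxt (show ends fx = s(x, c) by rw [hfx, Sym2.eq_swap]) (mem_openCluster_self _ x), hcBx⟩

/-- **THEOREM (the N-row on apex pieces).**  On a piece `D` with an apex `c` (spokes at `x` and `h` present) the class `N` has a dominating row for
EVERY target set `W` — realised by the identity: `HasDomRow ends D x (pieceN ends D x h W)`.  One third of `InU3 ends D x h` (CONJECTURE U3) for all cones, wheels
and apex graphs with the root edge off the apex. [cite: KozmaNitzan2024, Questions 8–9 (§5.5 p. 36) (context)] -/
theorem hasDomRow_pieceN_of_apex {D : Finset ι} {c x h : V} (hapex : ∀ e ∈ D, ∀ v : V, v ∈ ends e → v ≠ c → ∃ f ∈ D, ends f = s(c, v)) {fx fh : ι} (hfxD : fx ∈ D) (hfx : ends fx = s(c, x))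
    (hfhD : fh ∈ D) (hfh : ends fh = s(c, h)) (W : Set V) :
    HasDomRow ends D x (pieceN ends D x h W) := by
  refine ⟨id, fun t ht hcl => ⟨ht, hcl⟩, fun t₁ t₂ _ _ _ _ h => h, fun t htD hcl => ?_⟩
  obtain ⟨hc, hc'⟩ := pieceN_apex ends hapex hfxD hfx hfhD hfh htD hcl
  exact apex_blue_subset_red ends hapex hc hc'


/-- **Classes `R0`/`R1` on an apex piece, apex a target.**  If `c` is an apex with spokes at `x` and `h`, `c ∈ W`, and `t` lies in `R0` or `R1` (`h ∈ A^x`, `h ∉ B^x`,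
no target in `A^x ∩ B^x`), then `c ∈ A^x` and `c ∉ B^x` (the spoke at `x` red forces the first; if it is blue, the spoke at `h` puts `c` into `A^x` anyway or `h`
into `B^x`; and a target apex cannot be a core vertex). [cite: KozmaNitzan2024, Questions 8–9 (§5.5 p. 36) (context)] -/
theorem pieceR_apex_mem {D : Finset ι} {c x h : V} {fx fh : ι} (hfxD : fx ∈ D) (hfx : ends fx = s(c, x))
    (hfhD : fh ∈ D) (hfh : ends fh = s(c, h)) {W : Set V} (hcW : c ∈ W) {t : Finset ι}
    (hhA : h ∈ openCluster (ends '' (↑t : Set ι)) x) (hhB : h ∉ openCluster (ends '' (↑(D \ t) : Set ι)) x)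
    (hcore : ∀ w ∈ W, ¬ (w ∈ openCluster (ends '' (↑t : Set ι)) x ∧ w ∈ openCluster (ends '' (↑(D \ t) : Set ι)) x)) :
    c ∈ openCluster (ends '' (↑t : Set ι)) x ∧ c ∉ openCluster (ends '' (↑(D \ t) : Set ι)) x := by
  have hcA : c ∈ openCluster (ends '' (↑t : Set ι)) x := by
    by_cases hfxt : fx ∈ t
    · exact mem_openCluster_of_edge ends hfxt (show ends fx = s(x, c) by rw [hfx, Sym2.eq_swap]) (mem_openCluster_self _ x)
    · have hcBx : c ∈ openCluster (ends '' (↑(D \ t) : Set ι)) x :=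
        mem_openCluster_of_edge ends (Finset.mem_sdiff.mpr ⟨hfxD, hfxt⟩) (show ends fx = s(x, c) by rw [hfx, Sym2.eq_swap]) (mem_openCluster_self _ x)
      by_cases hfht : fh ∈ t
      · -- spoke at `h` red: `c` hangs red from `h ∈ A^x`
        exact mem_openCluster_of_edge ends hfht (show ends fh = s(h, c) by rw [hfh, Sym2.eq_swap]) hhA
      · exact absurd (mem_openCluster_of_edge ends (Finset.mem_sdiff.mpr ⟨hfhD, hfht⟩) hfh hcBx) hhB
  exact ⟨hcA, fun hcB => hcore c hcW ⟨hcA, hcB⟩⟩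

/-- On an apex piece with the apex a target (`c ∈ W`), the row of class `R0` holds with the identity. [cite: KozmaNitzan2024, Questions 8–9 (§5.5 p. 36) (context)] -/
theorem hasDomRow_pieceR0_of_apex_mem {D : Finset ι} {c x h : V} (hapex : ∀ e ∈ D, ∀ v : V, v ∈ ends e → v ≠ c → ∃ f ∈ D, ends f = s(c, v))
    {fx fh : ι} (hfxD : fx ∈ D) (hfx : ends fx = s(c, x)) (hfhD : fh ∈ D) (hfh : ends fh = s(c, h)) {W : Set V} (hcW : c ∈ W) :
    HasDomRow ends D x (pieceR0 ends D x h W) := by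
  refine ⟨id, fun t ht hcl => ⟨ht, hcl⟩, fun t₁ t₂ _ _ _ _ h => h, fun t _ hcl => ?_⟩
  obtain ⟨hhA, hhB, hcore, -⟩ := hcl
  obtain ⟨hc, hc'⟩ := pieceR_apex_mem ends hfxD hfx hfhD hfh hcW hhA hhB hcore
  exact apex_blue_subset_red ends hapex hc hc'

/-- On an apex piece with the apex a target (`c ∈ W`), the row of class `R1` holds with the identity. [cite: KozmaNitzan2024, Questions 8–9 (§5.5 p. 36) (context)] -/
theorem hasDomRow_pieceR1_of_apex_mem {D : Finset ι} {c x h : V} (hapex : ∀ e ∈ D, ∀ v : V, v ∈ ends e → v ≠ c → ∃ f ∈ D, ends f = s(c, v))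
    {fx fh : ι} (hfxD : fx ∈ D) (hfx : ends fx = s(c, x)) (hfhD : fh ∈ D) (hfh : ends fh = s(c, h)) {W : Set V} (hcW : c ∈ W) :
    HasDomRow ends D x (pieceR1 ends D x h W) := by
  refine ⟨id, fun t ht hcl => ⟨ht, hcl⟩, fun t₁ t₂ _ _ _ _ h => h, fun t _ hcl => ?_⟩
  obtain ⟨hhA, hhB, hcore, -⟩ := hcl
  obtain ⟨hc, hc'⟩ := pieceR_apex_mem ends hfxD hfx hfhD hfh hcW hhA hhB hcore
  exact apex_blue_subset_red ends hapex hc hc'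

open Classical in
/-- **THEOREM (REM on cones when the apex is a target).**  Let `e ∈ E` be a root edge with ends `{x,p}`, `p ≠ x`, and let `c` be an apex of `D = E.erase e` with spokes
`fx` (ends `{c,x}`) and `fh` (ends `{c,p}`) in `D`.  Then for every target set `W` CONTAINING `c` and every monotone `g`: `0 ≤ REM_E(e; x, W)[g]` — all three rows of
CONJECTURE U3 hold with the identity (`hasDomRow_pieceN_of_apex`, `…R0/R1_of_apex_mem`), and THEOREM 0 (`rem_nonneg_of_pieceRows_union`) assembles them.
So (REM) holds on every wheel / cone / complete graph for every root edge avoiding a dominating vertex that is a target.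
[cite: KozmaNitzan2024, Questions 8–9 (§5.5 p. 36) (context)] -/
theorem rem_nonneg_of_apex_mem (E : Finset ι) {e : ι} (he : e ∈ E) {x p : V} (hxp : ends e = s(x, p)) (hpx : p ≠ x) {c : V}
    (hapex : ∀ e' ∈ E.erase e, ∀ v : V, v ∈ ends e' → v ≠ c → ∃ f ∈ E.erase e, ends f = s(c, v))
    {fx fh : ι} (hfxD : fx ∈ E.erase e) (hfx : ends fx = s(c, x)) (hfhD : fh ∈ E.erase e) (hfh : ends fh = s(c, p))
    (W : Set V) (hcW : c ∈ W) (g : Set V → ℝ) (hg : Monotone g) :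
    0 ≤ ∑ s ∈ E.powerset.filter (fun s : Finset ι => e ∈ s ∧
          ∀ w ∈ W, ¬ (w ∈ openCluster (ends '' (↑s : Set ι)) x ∧ w ∈ openCluster (ends '' (↑(E \ s) : Set ι)) x)),
      (g (openCluster (ends '' (↑s : Set ι)) x) - g (openCluster (ends '' (↑(E \ s) : Set ι)) x)) := by
  have h0 := sum_nonneg_of_hasDomRow ends (E.erase e) x p _ (hasDomRow_pieceR0_of_apex_mem ends hapex hfxD hfx hfhD hfh hcW) g hg
  have h1 := sum_nonneg_of_hasDomRow ends (E.erase e) x p _ (hasDomRow_pieceR1_of_apex_mem ends hapex hfxD hfx hfhD hfh hcW) g hg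
  have h2 := sum_nonneg_of_hasDomRow ends (E.erase e) x p _ (hasDomRow_pieceN_of_apex ends hapex hfxD hfx hfhD hfh W) g hg
  refine rem_nonneg_of_pieceRows_union ends E he hxp hpx W g hg ?_ (fun _ => ?_) ?_
  · refine le_of_le_of_eq h1 (Finset.sum_congr (Finset.filter_congr fun t _ => ?_) fun _ _ => rfl)
    simp only [pieceR1]
  · refine le_of_le_of_eq h0 (Finset.sum_congr (Finset.filter_congr fun t _ => ?_) fun _ _ => rfl)
    simp only [pieceR0]
  · refine le_of_le_of_eq h2 (Finset.sum_congr (Finset.filter_congr fun t _ => ?_) fun _ _ => rfl)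
    simp only [pieceN]


/-- **Second terminal dominating ⇒ the R-rows hold with the identity.**  If `h` is joined by an edge of `D` to every vertex `v ≠ h` on an edge of `D`, and `t ⊆ D` has
`h ∈ A^x`, `h ∉ B^x`, then `B^x ⊆ A^x` pointwise: a vertex `v ≠ x` of `B^x` has its edge to `h`, which cannot be blue (else `h ∈ B^x`), so `v` hangs red from `h ∈ A^x`.
(Spoke root of a wheel / cone with `x` on the rim and `p` = the hub: the classes `R0`, `R1` of `D = G − e` need no bijection.) [cite: KozmaNitzan2024, Questions 8–9 (§5.5 p. 36) (context)] -/
theorem blue_subset_red_of_apex_snd {D : Finset ι} {x h : V} (hdom : ∀ e ∈ D, ∀ v : V, v ∈ ends e → v ≠ h → ∃ f ∈ D, ends f = s(h, v)) {t : Finset ι}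
    (hhA : h ∈ openCluster (ends '' (↑t : Set ι)) x) (hhB : h ∉ openCluster (ends '' (↑(D \ t) : Set ι)) x) :
    openCluster (ends '' (↑(D \ t) : Set ι)) x ⊆ openCluster (ends '' (↑t : Set ι)) x := by
  intro v hv
  by_cases hvx : v = x
  · subst hvx; exact mem_openCluster_self _ _
  have hvh : v ≠ h := fun hv' => hhB (hv' ▸ hv)
  obtain ⟨e, heDt, hve⟩ := exists_edge_of_mem_openCluster ends hv hvx
  obtain ⟨f, hfD, hfe⟩ := hdom e (Finset.mem_sdiff.mp heDt).1 v hve hvh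
  by_cases hft : f ∈ t
  · -- the edge `hv` is red: `v` hangs red from `h ∈ A^x`
    exact mem_openCluster_of_edge ends hft hfe hhA
  · -- the edge `hv` is blue: then `h ∈ B^x`
    exact absurd (mem_openCluster_of_edge ends (Finset.mem_sdiff.mpr ⟨hfD, hft⟩) (show ends f = s(v, h) by rw [hfe, Sym2.eq_swap]) hv) hhB

/-- Row of class `R0` by the identity when the second terminal `h` is dominating (every `W`). [cite: KozmaNitzan2024, Questions 8–9 (§5.5 p. 36) (context)] -/
theorem hasDomRow_pieceR0_of_apex_snd {D : Finset ι} {x h : V} (hdom : ∀ e ∈ D, ∀ v : V, v ∈ ends e → v ≠ h → ∃ f ∈ D, ends f = s(h, v)) (W : Set V) :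
    HasDomRow ends D x (pieceR0 ends D x h W) := by
  refine ⟨id, fun t ht hcl => ⟨ht, hcl⟩, fun t₁ t₂ _ _ _ _ h => h, fun t _ hcl => ?_⟩
  obtain ⟨hhA, hhB, -⟩ := hcl
  exact blue_subset_red_of_apex_snd ends hdom hhA hhB

/-- Row of class `R1` by the identity when the second terminal `h` is dominating (every `W`). [cite: KozmaNitzan2024, Questions 8–9 (§5.5 p. 36) (context)] -/
theorem hasDomRow_pieceR1_of_apex_snd {D : Finset ι} {x h : V} (hdom : ∀ e ∈ D, ∀ v : V, v ∈ ends e → v ≠ h → ∃ f ∈ D, ends f = s(h, v)) (W : Set V) :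
    HasDomRow ends D x (pieceR1 ends D x h W) := by
  refine ⟨id, fun t ht hcl => ⟨ht, hcl⟩, fun t₁ t₂ _ _ _ _ h => h, fun t _ hcl => ?_⟩
  obtain ⟨hhA, hhB, -⟩ := hcl
  exact blue_subset_red_of_apex_snd ends hdom hhA hhB

open Classical in
/-- **Spoke root, rim side: (REM) from the N-row alone.**  For a root edge `e = xp` such that `p` is joined in `D = E.erase e` to every vertex `v ≠ p` of `D` (e.g. `p` the
hub of a wheel or cone, `x` on the rim), the classes `R0`, `R1` have identity rows, so `REM_E(e;x,W)[g] ≥ 0` for every `W` and monotone `g` as soon as the class `N` of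
`(D; x, p)` has a row. [cite: KozmaNitzan2024, Questions 8–9 (§5.5 p. 36) (context)] -/
theorem rem_nonneg_of_apex_snd_of_pieceN (E : Finset ι) {e : ι} (he : e ∈ E) {x p : V} (hxp : ends e = s(x, p)) (hpx : p ≠ x)
    (hdom : ∀ e' ∈ E.erase e, ∀ v : V, v ∈ ends e' → v ≠ p → ∃ f ∈ E.erase e, ends f = s(p, v))
    (W : Set V) (hN : HasDomRow ends (E.erase e) x (pieceN ends (E.erase e) x p W)) (g : Set V → ℝ) (hg : Monotone g) :
    0 ≤ ∑ s ∈ E.powerset.filter (fun s : Finset ι => e ∈ s ∧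
          ∀ w ∈ W, ¬ (w ∈ openCluster (ends '' (↑s : Set ι)) x ∧ w ∈ openCluster (ends '' (↑(E \ s) : Set ι)) x)),
      (g (openCluster (ends '' (↑s : Set ι)) x) - g (openCluster (ends '' (↑(E \ s) : Set ι)) x)) := by
  have h0 := sum_nonneg_of_hasDomRow ends (E.erase e) x p _ (hasDomRow_pieceR0_of_apex_snd ends hdom W) g hg
  have h1 := sum_nonneg_of_hasDomRow ends (E.erase e) x p _ (hasDomRow_pieceR1_of_apex_snd ends hdom W) g hg
  have h2 := sum_nonneg_of_hasDomRow ends (E.erase e) x p _ hN g hg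
  refine rem_nonneg_of_pieceRows_union ends E he hxp hpx W g hg ?_ (fun _ => ?_) ?_
  · refine le_of_le_of_eq h1 (Finset.sum_congr (Finset.filter_congr fun t _ => ?_) fun _ _ => rfl)
    simp only [pieceR1]
  · refine le_of_le_of_eq h0 (Finset.sum_congr (Finset.filter_congr fun t _ => ?_) fun _ _ => rfl)
    simp only [pieceR0]
  · refine le_of_le_of_eq h2 (Finset.sum_congr (Finset.filter_congr fun t _ => ?_) fun _ _ => rfl)
    simp only [pieceN]


open Classical in
/-- **Cones: (REM) from the two point rows alone.**  For a root edge `e = xp` such that `D = E.erase e` has an apex `c` with spokes at `x` and `p`, the N-row holds by the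
identity (`hasDomRow_pieceN_of_apex`), so `REM_E(e;x,W)[g] ≥ 0` for every `W` and monotone `g` as soon as the classes `R0` and `R1` of `(D; x, p)` have rows
(CONJECTURE APEX-R of the memo; automatic when `c ∈ W`, `rem_nonneg_of_apex_mem`). [cite: KozmaNitzan2024, Questions 8–9 (§5.5 p. 36) (context)] -/
theorem rem_nonneg_of_apex_of_pieceR (E : Finset ι) {e : ι} (he : e ∈ E) {x p : V} (hxp : ends e = s(x, p)) (hpx : p ≠ x) {c : V}
    (hapex : ∀ e' ∈ E.erase e, ∀ v : V, v ∈ ends e' → v ≠ c → ∃ f ∈ E.erase e, ends f = s(c, v))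
    {fx fh : ι} (hfxD : fx ∈ E.erase e) (hfx : ends fx = s(c, x)) (hfhD : fh ∈ E.erase e) (hfh : ends fh = s(c, p)) (W : Set V)
    (hR0 : HasDomRow ends (E.erase e) x (pieceR0 ends (E.erase e) x p W)) (hR1 : HasDomRow ends (E.erase e) x (pieceR1 ends (E.erase e) x p W))
    (g : Set V → ℝ) (hg : Monotone g) :
    0 ≤ ∑ s ∈ E.powerset.filter (fun s : Finset ι => e ∈ s ∧
          ∀ w ∈ W, ¬ (w ∈ openCluster (ends '' (↑s : Set ι)) x ∧ w ∈ openCluster (ends '' (↑(E \ s) : Set ι)) x)),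
      (g (openCluster (ends '' (↑s : Set ι)) x) - g (openCluster (ends '' (↑(E \ s) : Set ι)) x)) := by
  have h0 := sum_nonneg_of_hasDomRow ends (E.erase e) x p _ hR0 g hg
  have h1 := sum_nonneg_of_hasDomRow ends (E.erase e) x p _ hR1 g hg
  have h2 := sum_nonneg_of_hasDomRow ends (E.erase e) x p _ (hasDomRow_pieceN_of_apex ends hapex hfxD hfx hfhD hfh W) g hg
  refine rem_nonneg_of_pieceRows_union ends E he hxp hpx W g hg ?_ (fun _ => ?_) ?_
  · refine le_of_le_of_eq h1 (Finset.sum_congr (Finset.filter_congr fun t _ => ?_) fun _ _ => rfl)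
    simp only [pieceR1]
  · refine le_of_le_of_eq h0 (Finset.sum_congr (Finset.filter_congr fun t _ => ?_) fun _ _ => rfl)
    simp only [pieceR0]
  · refine le_of_le_of_eq h2 (Finset.sum_congr (Finset.filter_congr fun t _ => ?_) fun _ _ => rfl)
    simp only [pieceN]


/-- **Second terminal joined to every vertex other than `x` — the spoke-root hypothesis.**  (`blue_subset_red_of_apex_snd` asks for an edge `hv` also for `v = x`, which the
spoke-root piece `E.erase e` does not have; this is the form that applies there.)  If every vertex `v ∉ {x, h}` on an edge of `D` is joined to `h` by an edge of `D`, and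
`h ∈ A^x`, `h ∉ B^x`, then `B^x ⊆ A^x`. [cite: KozmaNitzan2024, Questions 8–9 (§5.5 p. 36) (context)] -/
theorem blue_subset_red_of_dom_snd {D : Finset ι} {x h : V} (hdom : ∀ e ∈ D, ∀ v : V, v ∈ ends e → v ≠ h → v ≠ x → ∃ f ∈ D, ends f = s(h, v))
    {t : Finset ι} (hhA : h ∈ openCluster (ends '' (↑t : Set ι)) x) (hhB : h ∉ openCluster (ends '' (↑(D \ t) : Set ι)) x) :
    openCluster (ends '' (↑(D \ t) : Set ι)) x ⊆ openCluster (ends '' (↑t : Set ι)) x := by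
  intro v hv
  by_cases hvx : v = x
  · subst hvx; exact mem_openCluster_self _ _
  have hvh : v ≠ h := fun hv' => hhB (hv' ▸ hv)
  obtain ⟨e, heDt, hve⟩ := exists_edge_of_mem_openCluster ends hv hvx
  obtain ⟨f, hfD, hfe⟩ := hdom e (Finset.mem_sdiff.mp heDt).1 v hve hvh hvx
  by_cases hft : f ∈ t
  · exact mem_openCluster_of_edge ends hft hfe hhA
  · exact absurd (mem_openCluster_of_edge ends (Finset.mem_sdiff.mpr ⟨hfD, hft⟩) (show ends f = s(v, h) by rw [hfe, Sym2.eq_swap]) hv) hhB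

/-- Row of class `R0` by the identity under the spoke-root hypothesis (`h` joined to every vertex `∉ {x,h}`). [cite: KozmaNitzan2024, Questions 8–9 (§5.5 p. 36) (context)] -/
theorem hasDomRow_pieceR0_of_dom_snd {D : Finset ι} {x h : V} (hdom : ∀ e ∈ D, ∀ v : V, v ∈ ends e → v ≠ h → v ≠ x → ∃ f ∈ D, ends f = s(h, v)) (W : Set V) :
    HasDomRow ends D x (pieceR0 ends D x h W) := by
  refine ⟨id, fun t ht hcl => ⟨ht, hcl⟩, fun t₁ t₂ _ _ _ _ h => h, fun t _ hcl => ?_⟩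
  obtain ⟨hhA, hhB, -⟩ := hcl
  exact blue_subset_red_of_dom_snd ends hdom hhA hhB

/-- Row of class `R1` by the identity under the spoke-root hypothesis (`h` joined to every vertex `∉ {x,h}`). [cite: KozmaNitzan2024, Questions 8–9 (§5.5 p. 36) (context)] -/
theorem hasDomRow_pieceR1_of_dom_snd {D : Finset ι} {x h : V} (hdom : ∀ e ∈ D, ∀ v : V, v ∈ ends e → v ≠ h → v ≠ x → ∃ f ∈ D, ends f = s(h, v)) (W : Set V) :
    HasDomRow ends D x (pieceR1 ends D x h W) := by
  refine ⟨id, fun t ht hcl => ⟨ht, hcl⟩, fun t₁ t₂ _ _ _ _ h => h, fun t _ hcl => ?_⟩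
  obtain ⟨hhA, hhB, -⟩ := hcl
  exact blue_subset_red_of_dom_snd ends hdom hhA hhB

open Classical in
/-- **Spoke root of a cone, base side: (REM) from the LINEAR N-row.**  For a root edge `e = xp` with `p` joined in `D = E.erase e` to every vertex `∉ {x,p}` of `D` (e.g. `p`
the apex of a cone / the hub of a wheel, `x` a base / rim vertex), the point rows hold by the identity, so `REM_E(e;x,W)[g] ≥ 0` as soon as the class `N` of `(D;x,p)`
satisfies the linear inequality `0 ≤ Σ_{t ⊆ D, N t} (g(C_x t ∪ C_p t) − g(C_x(D∖t)))` — which the memo (CW-STRIP-gen70 §5d, THEOREM (★★)) proves for every graph on paper.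
[cite: KozmaNitzan2024, Questions 8–9 (§5.5 p. 36) (context)] -/
theorem rem_nonneg_of_dom_snd_of_rowN (E : Finset ι) {e : ι} (he : e ∈ E) {x p : V} (hxp : ends e = s(x, p)) (hpx : p ≠ x)
    (hdom : ∀ e' ∈ E.erase e, ∀ v : V, v ∈ ends e' → v ≠ p → v ≠ x → ∃ f ∈ E.erase e, ends f = s(p, v))
    (W : Set V) (g : Set V → ℝ) (hg : Monotone g)
    (hN : 0 ≤ ∑ t ∈ (E.erase e).powerset.filter (fun t => pieceN ends (E.erase e) x p W t),
      (g (openCluster (ends '' (↑t : Set ι)) x ∪ openCluster (ends '' (↑t : Set ι)) p) - g (openCluster (ends '' (↑((E.erase e) \ t) : Set ι)) x))) :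
    0 ≤ ∑ s ∈ E.powerset.filter (fun s : Finset ι => e ∈ s ∧
          ∀ w ∈ W, ¬ (w ∈ openCluster (ends '' (↑s : Set ι)) x ∧ w ∈ openCluster (ends '' (↑(E \ s) : Set ι)) x)),
      (g (openCluster (ends '' (↑s : Set ι)) x) - g (openCluster (ends '' (↑(E \ s) : Set ι)) x)) := by
  have h0 := sum_nonneg_of_hasDomRow ends (E.erase e) x p _ (hasDomRow_pieceR0_of_dom_snd ends hdom W) g hg
  have h1 := sum_nonneg_of_hasDomRow ends (E.erase e) x p _ (hasDomRow_pieceR1_of_dom_snd ends hdom W) g hg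
  refine rem_nonneg_of_pieceRows_union ends E he hxp hpx W g hg ?_ (fun _ => ?_) ?_
  · refine le_of_le_of_eq h1 (Finset.sum_congr (Finset.filter_congr fun t _ => ?_) fun _ _ => rfl)
    simp only [pieceR1]
  · refine le_of_le_of_eq h0 (Finset.sum_congr (Finset.filter_congr fun t _ => ?_) fun _ _ => rfl)
    simp only [pieceR0]
  · refine le_of_le_of_eq hN (Finset.sum_congr (Finset.filter_congr fun t _ => ?_) fun _ _ => rfl)
    simp only [pieceN]


/-- **Harris on a finite Boolean cube, difference form** — the inequality behind THEOREM (★★) of the memo (CW-STRIP-gen70 §5d: the apex-weighted double-cluster form is a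
positive combination, over the vertex sets `R = A ∪ B`, of exactly these cube sums indexed by the components of `R − x`): for monotone `φ ψ : Finset β → ℝ`,
`0 ≤ Σ_I (φ I − φ Iᶜ)(ψ I − ψ Iᶜ)`.  Proof: `= 2(Σ φψ − Σ_I φ(I)ψ(Iᶜ))` and two applications of Mathlib's `fkg` (counting measure on the Boolean lattice `Finset β`) give
`card · Σ_I φ(I)ψ(Iᶜ) ≤ (Σφ)(Σψ) ≤ card · Σ φψ`. [cite: KozmaNitzan2024, Questions 8–9 (§5.5 p. 36) (context); the inequality is Harris/FKG, AhlswedeDaykin1978] -/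
theorem cube_harris_diff_nonneg {β : Type*} [Fintype β] [DecidableEq β] (φ ψ : Finset β → ℝ)
    (hφ : Monotone φ) (hψ : Monotone ψ) :
    0 ≤ ∑ I : Finset β, (φ I - φ Iᶜ) * (ψ I - ψ Iᶜ) := by
  -- shift to nonnegative monotone functions
  set φ' : Finset β → ℝ := fun I => φ I - φ ∅ with hφ'
  set ψ' : Finset β → ℝ := fun I => ψ I - ψ ∅ with hψ'
  have hφ'm : Monotone φ' := fun I J h => by simp only [hφ']; linarith [hφ h]
  have hψ'm : Monotone ψ' := fun I J h => by simp only [hψ']; linarith [hψ h]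
  have hφ'0 : 0 ≤ φ' := fun I => by simp only [hφ', Pi.zero_apply]; linarith [hφ (Finset.empty_subset I)]
  have hψ'0 : 0 ≤ ψ' := fun I => by simp only [hψ', Pi.zero_apply]; linarith [hψ (Finset.empty_subset I)]
  have hrw : ∀ I : Finset β, (φ I - φ Iᶜ) * (ψ I - ψ Iᶜ) = (φ' I - φ' Iᶜ) * (ψ' I - ψ' Iᶜ) := by
    intro I; simp only [hφ', hψ']; ring
  simp_rw [hrw]
  -- the decreasing companions
  set ψc : Finset β → ℝ := fun I => ψ' univ - ψ' Iᶜ with hψc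
  have hψcm : Monotone ψc := fun I J h => by
    simp only [hψc]; linarith [hψ'm (Finset.compl_subset_compl.mpr h)]
  have hψc0 : 0 ≤ ψc := fun I => by simp only [hψc, Pi.zero_apply]; linarith [hψ'm (Finset.subset_univ Iᶜ)]
  -- FKG with the counting measure
  have hμ : ∀ a b : Finset β, (1 : ℝ) * 1 ≤ 1 * 1 := fun _ _ => le_rfl
  have fkg1 := fkg (μ := fun _ : Finset β => (1 : ℝ)) (f := φ') (g := ψ') (fun _ => zero_le_one) hφ'0 hψ'0 hφ'm hψ'm hμ
  have fkg2 := fkg (μ := fun _ : Finset β => (1 : ℝ)) (f := φ') (g := ψc) (fun _ => zero_le_one) hφ'0 hψc0 hφ'm hψcm hμ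
  simp only [one_mul, Finset.sum_const, nsmul_eq_mul, mul_one, Finset.card_univ] at fkg1 fkg2
  -- complement reindexing
  have ecomp : ∀ F : Finset β → ℝ, ∑ I : Finset β, F Iᶜ = ∑ I : Finset β, F I := fun F =>
    Fintype.sum_equiv (Equiv.mk (fun I : Finset β => Iᶜ) (fun I => Iᶜ) (fun I => compl_compl I) (fun I => compl_compl I)) _ _ (fun I => rfl)
  have hc1 : ∑ I : Finset β, ψ' Iᶜ = ∑ I : Finset β, ψ' I := ecomp ψ'
  have hc2 : ∑ I : Finset β, φ' Iᶜ * ψ' Iᶜ = ∑ I : Finset β, φ' I * ψ' I := ecomp (fun I => φ' I * ψ' I)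
  have hc3 : ∑ I : Finset β, φ' Iᶜ * ψ' I = ∑ I : Finset β, φ' I * ψ' Iᶜ := by
    rw [← ecomp (fun I => φ' I * ψ' Iᶜ)]
    exact Finset.sum_congr rfl (fun I _ => by simp only [compl_compl])
  -- expand the target
  have hexp : ∑ I : Finset β, (φ' I - φ' Iᶜ) * (ψ' I - ψ' Iᶜ)
      = 2 * ∑ I : Finset β, φ' I * ψ' I - 2 * ∑ I : Finset β, φ' I * ψ' Iᶜ := by
    have : ∀ I : Finset β, (φ' I - φ' Iᶜ) * (ψ' I - ψ' Iᶜ) = (φ' I * ψ' I + φ' Iᶜ * ψ' Iᶜ) - (φ' I * ψ' Iᶜ + φ' Iᶜ * ψ' I) := fun I => by ring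
    simp_rw [this]
    rw [Finset.sum_sub_distrib, Finset.sum_add_distrib, Finset.sum_add_distrib, hc2, hc3]; ring
  rw [hexp]
  -- rewrite the sums appearing in fkg2
  have e2 : ∑ I : Finset β, φ' I * ψc I = ψ' univ * ∑ I : Finset β, φ' I - ∑ I : Finset β, φ' I * ψ' Iᶜ := by
    have : ∀ I : Finset β, φ' I * ψc I = ψ' univ * φ' I - φ' I * ψ' Iᶜ := fun I => by simp only [hψc]; ring
    simp_rw [this]
    rw [Finset.sum_sub_distrib, ← Finset.mul_sum]
  have e3 : ∑ I : Finset β, ψc I = (Fintype.card (Finset β) : ℝ) * ψ' univ - ∑ I : Finset β, ψ' I := by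
    have : ∀ I : Finset β, ψc I = ψ' univ - ψ' Iᶜ := fun I => rfl
    simp_rw [this]
    rw [Finset.sum_sub_distrib, Finset.sum_const, nsmul_eq_mul, Finset.card_univ, hc1]
  rw [e2, e3] at fkg2
  have hcard : (0 : ℝ) < (Fintype.card (Finset β) : ℝ) := by exact_mod_cast Fintype.card_pos
  -- N·X ≤ P·Q ≤ N·S
  set N : ℝ := (Fintype.card (Finset β) : ℝ)
  set P : ℝ := ∑ I : Finset β, φ' I
  set Q : ℝ := ∑ I : Finset β, ψ' I
  set S : ℝ := ∑ I : Finset β, φ' I * ψ' I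
  set X : ℝ := ∑ I : Finset β, φ' I * ψ' Iᶜ
  have h1 : N * X ≤ P * Q := by nlinarith [fkg2]
  have h2 : P * Q ≤ N * S := fkg1
  have h3 : X ≤ S := le_of_mul_le_mul_left (h1.trans h2) hcard
  linarith


end Coefficientwise

end Summit.CriticalPhenomena.PercolationContinuityZ3.Theorems
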